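import Literature.Analysis.FluidPDE.HolderCZKernel
import HarnessLib

/-!
# Logarithmic potential estimates for the gradient of the Newtonian kernel on `ℝ³`

Topic `Literature/Analysis/FluidPDE`. Support file (all results proved, no named facts, no
definitions) for the interior part of the `δ`-family of `L^∞` div–curl estimates
`ShirotaYanagisawa1993_periodicCylinderDeltaLogDivCurlEstimate` (`PeriodicCylinderLogDivCurl.lean`;
Ferrari 1993, proof of Prop. 1, interior estimate (36)–(50), pp. 286–289). In the printed proof the
gradient of the velocity is a singular integral of the vorticity; the kernel is split at a radius
`δ`: the annulus `δ < |x − y| < R` contributes `∫ |x−y|^{-3} ≤ C₁ − C₂ log δ` times `|φ|_{L^∞}`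
((37) p. 287), and the ball `|x − y| < 2δ` contributes, after one derivative has been moved onto the
vorticity, `C ∫_{|x−y|<2δ} |x−y|^{-2} |Dφ(y)| dy ≤ C δ^{1/2} ‖Dφ‖_{L⁶}` by Hölder's inequality and
Sobolev's theorem ((48) p. 288). This file proves the two kernel computations in the tree's setting
(`newtonKernel Γ = −1/(4π|z|)`, `newtonKernelGrad j = ∂ⱼΓ = zⱼ/(4π|z|³)`):

* `integral_annulus_norm_rpow_neg_three` — **the logarithm**:
  `∫_{a ≤ |z| < b} |z|^{-3} dz = 3|B₁| log(b/a)` (polar coordinates, `integral_fun_norm_addHaar`);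
* `IsHolderCZKernel.norm_czDiff_le_log` — **the logarithmic sup bound in Hölder form**
  (Majda–Bertozzi, Lemma 4.6 (4.35) with a general radius `ε`): for a compactly supported
  Calderón–Zygmund kernel of Hölder theory (`IsHolderCZKernel K ρ A B A₀`, `HolderCZKernel.lean`),
  a `γ`-Hölder `f` bounded by `M` and `0 < ε ≤ ρ`,
  `‖∫ K(x − y)(f(y) − f(x)) dy‖ ≤ A·3|B₁|·(C_f ε^γ/γ + 2M log(ρ/ε))`
  (near ball by Hölder continuity, annulus `ε ≤ |x − y| < ρ` by the logarithm);
* `abs_setIntegral_ball_newtonKernelGrad_mul_le` — **the near field in Sobolev form**: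
  `|∫_{B(x,δ)} ∂ⱼΓ(x − y) F(y) dy| ≤ C₀ δ^{1/2} ‖F‖_{L⁶(B(x,δ))}` with the absolute constant
  `C₀ = (4π)⁻¹ (5|B₁|)^{5/6} √2` (the tree's `abs_potential_le` for the singular kernel `∂ⱼΓ` of
  degree `−2` and the conjugate exponents `p = 6`, `q = 6/5`: `3/q − 2 = 1/2`).

## Mathlib / tree search

Tree: `NewtonPotentialHolder.abs_potential_le`, `isSingularKernel_newtonKernelGrad`,
`integral_ball_norm_rpow_neg` / `integral_compl_ball_norm_rpow_neg` (exponents `≠ 3` only;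
`lean search 'annulus|log.*norm_rpow'`: no annulus integral with the critical exponent). Mathlib:
`integral_fun_norm_addHaar`, `integral_inv_of_pos`.

## References

* A. B. Ferrari, Comm. Math. Phys. 155 (1993) 277–294, proof of Prop. 1, (37) p. 287 and (48)
  p. 288. [Ferrari1993]
* A. J. Majda, A. L. Bertozzi, *Vorticity and Incompressible Flow* (2002), §4.1.3 Lemma 4.6 and
  §8 (potential theory estimates). [MajdaBertozziCUP2002]
-/

noncomputable section

open MeasureTheory Set Function Filter Topology TopologicalSpace Metric Real
open scoped NNReal ENNReal RealInnerProductSpace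

namespace Literature.Analysis.FluidPDE

namespace NewtonPotentialHolder

/-! ### The logarithm: `∫_{a ≤ |z| < b} |z|^{-3} dz = 3|B₁| log(b/a)` -/

/-- **Radial power integral on an annulus, critical exponent**:
`∫_{a ≤ |z| < b} |z|^{-3} dz = 3|B₁| log(b/a)` for `0 < a ≤ b` (polar coordinates,
`integral_fun_norm_addHaar`, and `∫_a^b y⁻¹ dy = log(b/a)`); the source of the logarithm in the
`L^∞` div–curl estimates (Ferrari 1993, (37) p. 287:
`C ∫_{δ<|x−y|<R} |x−y|^{-3} dy ≤ C₁ − C₂ log δ`).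
[cite: Ferrari1993, proof of Prop. 1, (37) p. 287] -/
theorem integral_annulus_norm_rpow_neg_three {a b : ℝ} (ha : 0 < a) (hab : a ≤ b) :
    ∫ z in ball (0 : EuclideanSpace ℝ (Fin 3)) b \ ball 0 a, ‖z‖ ^ (-3 : ℝ) =
      3 * (volume : Measure (EuclideanSpace ℝ (Fin 3))).real (ball 0 1) * Real.log (b / a) := by
  have hb : 0 < b := ha.trans_le hab
  set F : ℝ → ℝ := (Ico a b).indicator fun y => y ^ (-3 : ℝ) with hF
  have hS : MeasurableSet (ball (0 : EuclideanSpace ℝ (Fin 3)) b \ ball 0 a) :=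
    measurableSet_ball.diff measurableSet_ball
  have h1 : ∫ z in ball (0 : EuclideanSpace ℝ (Fin 3)) b \ ball 0 a, ‖z‖ ^ (-3 : ℝ) =
      ∫ z : EuclideanSpace ℝ (Fin 3), F ‖z‖ := by
    rw [← integral_indicator hS]
    congr 1
    funext z
    have hmem : z ∈ ball (0 : EuclideanSpace ℝ (Fin 3)) b \ ball 0 a ↔ ‖z‖ ∈ Ico a b := by
      simp only [Set.mem_sdiff, mem_ball_zero_iff, not_lt, mem_Ico]
      tauto
    by_cases hz : z ∈ ball (0 : EuclideanSpace ℝ (Fin 3)) b \ ball 0 a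
    · rw [indicator_of_mem hz, hF, indicator_of_mem (hmem.1 hz)]
    · rw [indicator_of_notMem hz, hF, indicator_of_notMem fun h => hz (hmem.2 h)]
  rw [h1, integral_fun_norm_addHaar, finrank_euclideanSpace_fin]
  have h2 : ∫ y in Ioi (0 : ℝ), y ^ (3 - 1) • F y = ∫ y in Ico a b, y⁻¹ := by
    have e : (fun y : ℝ => y ^ (3 - 1) • F y) =
        (Ico a b).indicator fun y => y ^ (2 : ℕ) * y ^ (-3 : ℝ) := by
      funext y
      rw [hF]
      by_cases hy : y ∈ Ico a b
      · simp [indicator_of_mem hy]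
      · simp [indicator_of_notMem hy]
    have hI : Ioi (0 : ℝ) ∩ Ico a b = Ico a b :=
      inter_eq_right.2 fun y hy => ha.trans_le hy.1
    rw [e, setIntegral_indicator measurableSet_Ico, hI]
    refine setIntegral_congr_fun measurableSet_Ico fun y hy => ?_
    have hy0 : 0 < y := ha.trans_le hy.1
    rw [← Real.rpow_natCast, ← Real.rpow_add hy0, ← Real.rpow_neg_one]
    norm_num
  have h3 : ∫ y in Ico a b, y⁻¹ = Real.log (b / a) := by
    rw [integral_Ico_eq_integral_Ioc, ← intervalIntegral.integral_of_le hab,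
      integral_inv_of_pos ha hb]
  rw [h2, h3]
  simp [smul_eq_mul]
  ring

/-- `|z|^{-3}` is integrable on the annulus `a ≤ |z| < b` for `a > 0` (bounded by `a^{-3}` on a
set of finite measure). [folklore] -/
theorem integrableOn_annulus_norm_rpow_neg_three {a : ℝ} (ha : 0 < a) (b : ℝ) :
    IntegrableOn (fun z : EuclideanSpace ℝ (Fin 3) => ‖z‖ ^ (-3 : ℝ))
      (ball (0 : EuclideanSpace ℝ (Fin 3)) b \ ball 0 a) volume := by
  refine (integrableOn_const (C := a ^ (-3 : ℝ)) ?_).mono' ?_ ?_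
  · exact ((measure_mono sdiff_subset).trans_lt measure_ball_lt_top).ne
  · exact (continuous_norm.measurable.pow_const _).aestronglyMeasurable
  · refine (ae_restrict_iff' (measurableSet_ball.diff measurableSet_ball)).2
      (Eventually.of_forall fun z hz => ?_)
    rw [Real.norm_of_nonneg (Real.rpow_nonneg (norm_nonneg _) _)]
    have hza : a ≤ ‖z‖ := by simpa using hz.2
    exact Real.rpow_le_rpow_of_nonpos ha hza (by norm_num)

/-- The annulus integral in `ℝ≥0∞` form:
`∫⁻_{a ≤ |z| < b} |z|^{-3} dz = ENNReal.ofReal (3|B₁| log(b/a))`. [folklore] -/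
theorem lintegral_annulus_norm_rpow_neg_three {a b : ℝ} (ha : 0 < a) (hab : a ≤ b) :
    ∫⁻ z in ball (0 : EuclideanSpace ℝ (Fin 3)) b \ ball 0 a, ENNReal.ofReal (‖z‖ ^ (-3 : ℝ)) =
      ENNReal.ofReal (3 * (volume : Measure (EuclideanSpace ℝ (Fin 3))).real (ball 0 1) *
        Real.log (b / a)) := by
  rw [← integral_annulus_norm_rpow_neg_three ha hab,
    ofReal_integral_eq_lintegral_ofReal (integrableOn_annulus_norm_rpow_neg_three ha b)
      (Eventually.of_forall fun z => Real.rpow_nonneg (norm_nonneg _) _)]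

/-! ### The near field in Sobolev form -/

/-- **Near-field bound for the gradient of the Newtonian kernel against an `L⁶` density**
(Ferrari 1993, (48) p. 288:
`C ∫_{|x−y|<2δ} |x−y|^{-2} |D_kφ_j(y)| dy ≤ C ‖Dφ‖_{L⁶} (∫ r^{-12/5} r² dr)^{5/6}
≤ C δ^{1/2} ‖φ‖_{H²(Ω)}`, "Hölder's inequality is applied in line three, and Sobolev's theorem in
line six"): for `δ > 0`, `x ∈ ℝ³` and `F ∈ L⁶(B(x, δ))`,
`|∫_{B(x,δ)} ∂ⱼΓ(x − y) F(y) dy| ≤ C₀ δ^{1/2} ‖F‖_{L⁶(B(x,δ))}`,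
`C₀ = (4π)⁻¹ (5|B₁|)^{5/6} √2`, from the tree's `abs_potential_le` (`∂ⱼΓ` is a singular kernel of
degree `−2`, `isSingularKernel_newtonKernelGrad`; `p = 6`, `q = 6/5`, `3/q − 2 = 1/2`) applied to
the
density `𝟙_{B(x,δ)} F`. [cite: Ferrari1993, proof of Prop. 1, (48) p. 288] -/
theorem abs_setIntegral_ball_newtonKernelGrad_mul_le (j : Fin 3) {x : EuclideanSpace ℝ (Fin 3)}
    {δ : ℝ} (hδ : 0 < δ) {F : EuclideanSpace ℝ (Fin 3) → ℝ}
    (hF : MemLp ((ball x δ).indicator F) 6 volume) :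
    |∫ y in ball x δ, newtonKernelGrad j (x - y) * F y| ≤
      (4 * π)⁻¹ * (3 * (volume : Measure (EuclideanSpace ℝ (Fin 3))).real (ball 0 1) /
          (3 - 2 * (6 / 5))) ^ (1 / (6 / 5 : ℝ)) * (2 * δ) ^ (3 / (6 / 5 : ℝ) - 2) *
        ((∫⁻ y in ball x δ, ‖F y‖ₑ ^ (6 : ℝ)) ^ (1 / (6 : ℝ))).toReal := by
  have hpq : (6 : ℝ).HolderConjugate (6 / 5) :=
    Real.holderConjugate_iff.2 ⟨by norm_num, by norm_num⟩
  have hk := isSingularKernel_newtonKernelGrad j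
  have hsupp : support ((ball x δ).indicator F) ⊆ ball x δ := support_indicator_subset
  have hf : MemLp ((ball x δ).indicator F) (ENNReal.ofReal 6) volume := by
    have : ENNReal.ofReal (6 : ℝ) = 6 := by norm_num
    rwa [this]
  have key := abs_potential_le hk (by positivity) hpq (by norm_num) hf hδ hsupp
    (mem_closedBall_self hδ.le)
  -- the potential of `𝟙_B F` is the set integral over the ball
  have hint : ∫ y, (ball x δ).indicator F y * newtonKernelGrad j (x - y) =
      ∫ y in ball x δ, newtonKernelGrad j (x - y) * F y := by
    rw [← integral_indicator measurableSet_ball]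
    congr 1
    funext y
    by_cases hy : y ∈ ball x δ
    · rw [indicator_of_mem hy, indicator_of_mem hy, mul_comm]
    · rw [indicator_of_notMem hy, indicator_of_notMem hy, zero_mul]
  -- the `L⁶` norm of `𝟙_B F` is the `L⁶(B)` norm of `F`
  have hnorm : ∫⁻ y, ‖(ball x δ).indicator F y‖ₑ ^ (6 : ℝ) =
      ∫⁻ y in ball x δ, ‖F y‖ₑ ^ (6 : ℝ) := by
    rw [← lintegral_indicator measurableSet_ball]
    congr 1
    funext y
    by_cases hy : y ∈ ball x δ
    · rw [indicator_of_mem hy, indicator_of_mem hy]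
    · rw [indicator_of_notMem hy, indicator_of_notMem hy, enorm_zero,
        ENNReal.zero_rpow_of_pos (by norm_num)]
  rw [hint, hnorm] at key
  exact key

/-- The exponent bookkeeping of `abs_setIntegral_ball_newtonKernelGrad_mul_le`:
`(2δ)^{3/(6/5) − 2} = √2 · δ^{1/2}`. [folklore] -/
theorem two_mul_rpow_near_exponent {δ : ℝ} (hδ : 0 ≤ δ) :
    (2 * δ) ^ (3 / (6 / 5 : ℝ) - 2) = Real.sqrt 2 * δ ^ (1 / 2 : ℝ) := by
  have h : (3 / (6 / 5 : ℝ) - 2) = 1 / 2 := by norm_num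
  rw [h, Real.mul_rpow (by norm_num) hδ, Real.sqrt_eq_rpow]

end NewtonPotentialHolder

/-! ### The logarithmic sup bound for Calderón–Zygmund kernels of Hölder theory -/

section LogHolder

open NewtonPotentialHolder

variable {F : Type*} [NormedAddCommGroup F] [NormedSpace ℝ F]
variable {K : EuclideanSpace ℝ (Fin 3) → ℝ} {ρ A B A₀ : ℝ} {f : EuclideanSpace ℝ (Fin 3) → F}
  {C γ : ℝ≥0}

/-- **The logarithmic sup bound** (Majda–Bertozzi, *Vorticity and Incompressible Flow*, §4.1.3
Lemma 4.6 (4.35): `|P_N f|₀ ≤ c{|f|_γ ε^γ + max(1, ln(R/ε)) |f|₀}` for the singular integral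
`P_N` of a compactly supported `f ∈ C^γ`; here for the tree's compactly supported
Calderón–Zygmund kernels of Hölder theory acting on differences, `czDiff K f x =
∫ K(x − y) • (f(y) − f(x)) dy`): if `‖f‖ ≤ M`, `f` is `γ`-Hölder with constant `C`, `0 < γ < 1`,
and `0 < ε ≤ ρ`, then `‖czDiff K f x‖ ≤ A · 3|B₁| · (C ε^γ/γ + 2M log(ρ/ε))`: the ball
`|x − y| < ε` is bounded by Hölder continuity (`norm_integral_le_of_indicator_ball`), the annulus
`ε ≤ |x − y| < ρ` by `|K| ≤ A|x−y|⁻³`, `‖f(y) − f(x)‖ ≤ 2M` and the logarithm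
(`lintegral_annulus_norm_rpow_neg_three`).
[cite: MajdaBertozziCUP2002, §4.1.3 Lemma 4.6 (4.35) (p. 129)] -/
theorem IsHolderCZKernel.norm_czDiff_le_log (hK : IsHolderCZKernel K ρ A B A₀)
    (hf : HolderWith C γ f)
    (hγ : 0 < γ) (hγ1 : γ < 1) {M : ℝ} (hM : ∀ y, ‖f y‖ ≤ M) {ε : ℝ} (hε : 0 < ε) (hερ : ε ≤ ρ)
    (x : EuclideanSpace ℝ (Fin 3)) :
    ‖czDiff K f x‖ ≤ A * (3 * (volume : Measure (EuclideanSpace ℝ (Fin 3))).real (ball 0 1)) *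
      (C * (ε ^ (γ : ℝ) / γ) + 2 * M * Real.log (ρ / ε)) := by
  have hγ3 : γ < 3 := hγ1.trans (by norm_num)
  have hγ' : (0 : ℝ) < γ := by exact_mod_cast hγ
  have hA : 0 ≤ A := hK.nonneg_A
  have hM0 : 0 ≤ M := (norm_nonneg _).trans (hM x)
  set V : ℝ := 3 * (volume : Measure (EuclideanSpace ℝ (Fin 3))).real (ball 0 1) with hV
  have hV0 : 0 ≤ V := three_mul_volume_real_ball_nonneg
  set G : EuclideanSpace ℝ (Fin 3) → F := fun y => K (x - y) • (f y - f x) with hG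
  have hGi : Integrable G := hK.integrable_czDiff hf hγ hγ1 x
  -- split the integrand at `|x − y| = ε`
  set G₁ : EuclideanSpace ℝ (Fin 3) → F := (ball x ε).indicator G with hG₁
  set G₂ : EuclideanSpace ℝ (Fin 3) → F := (ball x ε)ᶜ.indicator G with hG₂
  have hG₁i : Integrable G₁ := hGi.indicator measurableSet_ball
  have hG₂i : Integrable G₂ := hGi.indicator measurableSet_ball.compl
  have hsplit : czDiff K f x = (∫ y, G₁ y) + ∫ y, G₂ y := by
    rw [czDiff, ← integral_add hG₁i hG₂i]
    refine integral_congr_ae (Eventually.of_forall fun y => ?_)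
    simp only [hG₁, hG₂]
    by_cases hy : y ∈ ball x ε
    · rw [indicator_of_mem hy, indicator_of_notMem (fun h : y ∈ (ball x ε)ᶜ => h hy), add_zero]
    · rw [indicator_of_notMem hy, indicator_of_mem (mem_compl hy), zero_add]
  -- the near ball
  have h1 : ‖∫ y, G₁ y‖ ≤ A * C * V * (ε ^ (γ : ℝ) / γ) := by
    refine norm_integral_le_of_indicator_ball (p := x) hγ' hε (mul_nonneg hA C.coe_nonneg)
      fun y => ?_
    by_cases hy : y ∈ ball x ε
    · rw [hG₁, indicator_of_mem hy, indicator_of_mem hy, ← ofReal_norm]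
      exact ENNReal.ofReal_le_ofReal (hK.norm_smul_sub_le hf hγ3 x y)
    · rw [hG₁, indicator_of_notMem hy, indicator_of_notMem hy, enorm_zero]
  -- the annulus
  have h2 : ‖∫ y, G₂ y‖ ≤ A * (2 * M) * V * Real.log (ρ / ε) := by
    -- pointwise majorant `1_{ε ≤ |x−y| < ρ} · A (2M) |x − y|^{-3}`
    set m : EuclideanSpace ℝ (Fin 3) → ℝ≥0∞ :=
      (ball (0 : EuclideanSpace ℝ (Fin 3)) ρ \ ball 0 ε).indicator
        (fun z => ENNReal.ofReal (A * (2 * M)) * ENNReal.ofReal (‖z‖ ^ (-3 : ℝ))) with hm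
    have hmaj : ∀ y, ‖G₂ y‖ₑ ≤ m (x - y) := by
      intro y
      by_cases hy : y ∈ (ball x ε)ᶜ
      · rw [hG₂, indicator_of_mem hy]
        by_cases hρy : x - y ∈ ball (0 : EuclideanSpace ℝ (Fin 3)) ρ
        · have hann : x - y ∈ ball (0 : EuclideanSpace ℝ (Fin 3)) ρ \ ball 0 ε := by
            refine ⟨hρy, ?_⟩
            rw [mem_ball_zero_iff, not_lt]
            rw [mem_compl_iff, mem_ball, dist_eq_norm, norm_sub_rev, not_lt] at hy
            exact hy
          rw [hm, indicator_of_mem hann, ← ofReal_norm, ← ENNReal.ofReal_mul (by positivity)]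
          refine ENNReal.ofReal_le_ofReal ?_
          rw [hG, norm_smul, Real.norm_eq_abs]
          have hk := hK.singular.abs_le (x - y)
          have hfd : ‖f y - f x‖ ≤ 2 * M := by
            calc ‖f y - f x‖ ≤ ‖f y‖ + ‖f x‖ := norm_sub_le _ _
              _ ≤ M + M := add_le_add (hM y) (hM x)
              _ = 2 * M := by ring
          calc |K (x - y)| * ‖f y - f x‖ ≤ (A * ‖x - y‖ ^ (-(3 : ℝ))) * (2 * M) :=
                mul_le_mul hk hfd (norm_nonneg _) ((abs_nonneg _).trans hk)
            _ = A * (2 * M) * ‖x - y‖ ^ (-3 : ℝ) := by ring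
        · -- `|x − y| ≥ ρ`: the integrand vanishes
          have hρ' : ρ ≤ ‖x - y‖ := by rwa [mem_ball_zero_iff, not_lt] at hρy
          rw [hG]
          simp only
          rw [hK.smul_sub_eq_zero_of_le hρ', enorm_zero]
          exact zero_le
      · rw [hG₂, indicator_of_notMem hy, enorm_zero]
        exact zero_le
    have hmeas : Measurable fun z : EuclideanSpace ℝ (Fin 3) =>
        ENNReal.ofReal (A * (2 * M)) * ENNReal.ofReal (‖z‖ ^ (-3 : ℝ)) :=
      measurable_const.mul (continuous_norm.measurable.pow_const _).ennreal_ofReal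
    have hkey : ‖∫ y, G₂ y‖ₑ ≤ ENNReal.ofReal (A * (2 * M) * V * Real.log (ρ / ε)) := by
      calc ‖∫ y, G₂ y‖ₑ ≤ ∫⁻ y, ‖G₂ y‖ₑ := enorm_integral_le_lintegral_enorm _
        _ ≤ ∫⁻ y, m (x - y) := lintegral_mono hmaj
        _ = ∫⁻ z, m z := lintegral_sub_left_eq_self m x
        _ = ∫⁻ z in ball (0 : EuclideanSpace ℝ (Fin 3)) ρ \ ball 0 ε,
              ENNReal.ofReal (A * (2 * M)) * ENNReal.ofReal (‖z‖ ^ (-3 : ℝ)) := by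
            rw [hm, lintegral_indicator (measurableSet_ball.diff measurableSet_ball)]
        _ = ENNReal.ofReal (A * (2 * M)) *
              ∫⁻ z in ball (0 : EuclideanSpace ℝ (Fin 3)) ρ \ ball 0 ε,
                ENNReal.ofReal (‖z‖ ^ (-3 : ℝ)) :=
            lintegral_const_mul _ (continuous_norm.measurable.pow_const _).ennreal_ofReal
        _ = ENNReal.ofReal (A * (2 * M) * V * Real.log (ρ / ε)) := by
            rw [lintegral_annulus_norm_rpow_neg_three hε hερ, ← ENNReal.ofReal_mul (by positivity),
              hV]
            congr 1
            ring
    rw [← ofReal_norm] at hkey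
    have hlog : 0 ≤ Real.log (ρ / ε) := Real.log_nonneg ((one_le_div hε).2 hερ)
    exact (ENNReal.ofReal_le_ofReal_iff (by positivity)).1 hkey
  calc ‖czDiff K f x‖ = ‖(∫ y, G₁ y) + ∫ y, G₂ y‖ := by rw [hsplit]
    _ ≤ ‖∫ y, G₁ y‖ + ‖∫ y, G₂ y‖ := norm_add_le _ _
    _ ≤ A * C * V * (ε ^ (γ : ℝ) / γ) + A * (2 * M) * V * Real.log (ρ / ε) := add_le_add h1 h2
    _ = A * V * (C * (ε ^ (γ : ℝ) / γ) + 2 * M * Real.log (ρ / ε)) := by ring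

end LogHolder



end Literature.Analysis.FluidPDE
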